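import Summits.AtomisticToContinuum.Crystallization.Theorems.ChargedEnergyGapRotationExcision
import HarnessLib

/-!
# Charged energy gap — lens-3 g62, part P-Q: the decay-mode hypothesis and the (R3) fallback, TYPED

Cell `decomp-a2c`, seat lens-3, generation 62, part P-Q (after P-P `ChargedEnergyGapRotationExcision`).  TYPING ONLY (three definitions, their
elementary order lemmas, one link to (R2)); no piece of record is changed.  It answers critic rows 1124 (4) / 1131 (b) / 1137 (C) «type the
Bloch-fibre statement; kernel path or census-witnessed tag» and row 1137 (D)(v)(d) «(R3) stays the documented fallback».

* `HarmStablePhonon μ₀ P` — ★ PHONON STABILITY, ALL BLOCH FIBRES AT ONCE and presentation-free: for every FINITELY SUPPORTED displacement field `u`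
  on the point set, `μ₀ · Σ'_{y ∈ P} dirichletSite (δu) y ≤ Σ'_{y ∈ P} quadSite (δu) ∅ y`.  No gauge is needed (a finitely supported field has no
  rigid component).  WHERE THE k ≠ 0 POSITIVITY COMES FROM (row 1124 (4)): `HarmStableModRot μ₀ P` is the `k = 0` fibre of the PRESENTATION `P`;
  the transfer piece quantifies over every presentation of the same point set (supercells), whose `k = 0` fibres are the Bloch fibres `k ∈ Λ*_P/N`;
  `HarmStablePhonon` is the statement that bounds them all (by Bloch decomposition of a finitely supported field over any period cell — a
  Plancherel identity, kernel-owed [ATTACKABLE·M]) and is what the reduction should cite when it instantiates the transfer piece at a supercell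
  presentation.  STATUS: [census-witnessed, float ×1.9]: STAB-61 reading (S) — all Bloch fibres of fcc ≥ 0.01896, hcp ≥ 0.02666 (> 1/100), the floor
  being the transverse-acoustic limit `½ μ_aff` (evidence-g33/STAB61.md); kernel path = interval version of the census's Bloch scan + the Plancherel
  lemma (g63 agenda).
* `HasFinePeriod H₀ P`, `SiteVirialBound t₀ P` — the (R3) clauses of memo g61 §9.5, typed over `transSet` / `siteVirial`; `siteVirialBound_zero_of_
  siteStressFree : IsSiteStressFree P → SiteVirialBound 0 P` ((R2) ⊂ (R3) on that clause).  (R3) remains the DOCUMENTED FALLBACK only (row 1137 (D)(v)(d)).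
-/

noncomputable section

open scoped Classical

open Literature.MathematicalPhysics.StatisticalMechanics Literature.Geometry.DiscreteGeometry
open Summit.AtomisticToContinuum.Crystallization.Theses.PricedLinkCensus
open Summit.AtomisticToContinuum.Crystallization.Theorems.ChargedEnergyGapNegative

namespace Summit.AtomisticToContinuum.Crystallization.Theorems.ChargedEnergyGapChartDial

section Fibres

variable {P : PeriodicConfiguration 3}

/-- FINITELY SUPPORTED displacement fields living on the point set. -/
def IsFinitelySupported (P : PeriodicConfiguration 3) (u : E3 → E3) : Prop :=
  {p : E3 | u p ≠ 0}.Finite ∧ ∀ p : E3, p ∉ P.points → u p = 0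

/-- The zero field is finitely supported. -/
theorem isFinitelySupported_zero (P : PeriodicConfiguration 3) : IsFinitelySupported P fun _ => 0 :=
  ⟨by simp, fun _ _ => rfl⟩

/-- ★ **PHONON STABILITY** `HarmStablePhonon μ₀ P` (all Bloch fibres, presentation-free, gauge-free): for every finitely supported displacement
field the quadratic model energy of its coboundary dominates `μ₀ ×` its Dirichlet energy, both summed over the whole point set. [census-witnessed:
STAB-61 (S), fcc 0.01896 / hcp 0.02666 at μ₀ = 1/100, float ×1.9; kernel path owed] -/
def HarmStablePhonon (μ₀ : ℝ) (P : PeriodicConfiguration 3) : Prop :=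
  ∀ u : E3 → E3, IsFinitelySupported P u →
    μ₀ * (∑' y : P.points, dirichletSite (fieldCocycle u) P (y : E3)) ≤ ∑' y : P.points, quadSite (fieldCocycle u) P ∅ (y : E3)

/-- The Dirichlet site term is non-negative … -/
theorem dirichletSite_nonneg (β : E3 → E3 → E3) (P : PeriodicConfiguration 3) (y : E3) : 0 ≤ dirichletSite β P y :=
  tsum_nonneg fun _ => sq_nonneg _

/-- … so phonon stability is antitone in the margin. -/
theorem HarmStablePhonon.anti {μ₀ μ₀' : ℝ} (hμ : μ₀ ≤ μ₀') (h : HarmStablePhonon μ₀' P) : HarmStablePhonon μ₀ P := fun u hu =>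
  (mul_le_mul_of_nonneg_right hμ (tsum_nonneg fun _ => dirichletSite_nonneg _ P _)).trans (h u hu)

/-- Degenerate reading: at margin `0` phonon stability is the non-negativity of the quadratic model energy of finitely supported fields. -/
theorem harmStablePhonon_zero_iff : HarmStablePhonon 0 P ↔
    ∀ u : E3 → E3, IsFinitelySupported P u → 0 ≤ ∑' y : P.points, quadSite (fieldCocycle u) P ∅ (y : E3) := by
  simp [HarmStablePhonon]

end Fibres

section FallbackR3

variable {P : PeriodicConfiguration 3}

/-- (R3) **FINE PERIOD** `HasFinePeriod H₀ P`: the reference POINT SET (not the presentation) has a group of stabiliser translations of covering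
radius `≤ H₀` (record `H₀ = 10`: fcc, hcp, dhcp, 6H, 9R, … — every Barlow stacking of period ≤ 12 layers). -/
def HasFinePeriod (H₀ : ℝ) (P : PeriodicConfiguration 3) : Prop :=
  ∃ Λ₀ : AddSubgroup E3, (∀ g ∈ Λ₀, g ∈ transSet P) ∧ ∀ q : E3, ∃ g ∈ Λ₀, dist q g ≤ H₀

/-- (R3) **SITE-VIRIAL BOUND** `SiteVirialBound t₀ P`: at every site the deviatoric reading `|tr T_y − T_y(n, n)|` of the site virial along every
unit direction is at most `t₀` (record `t₀ = 1/400`; census POLY-61: every relaxed Barlow stacking has `≤ 1.6·10⁻³`). -/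
def SiteVirialBound (t₀ : ℝ) (P : PeriodicConfiguration 3) : Prop :=
  ∀ y ∈ P.motif, ∀ n : E3, ‖n‖ = 1 →
    |(∑ i : Fin 3, siteVirial P y (EuclideanSpace.single i 1) (EuclideanSpace.single i 1)) - siteVirial P y n n| ≤ t₀

/-- The fine-period clause is monotone in the radius. -/
theorem HasFinePeriod.mono {H₀ H₀' : ℝ} (hH : H₀ ≤ H₀') (h : HasFinePeriod H₀ P) : HasFinePeriod H₀' P := by
  obtain ⟨Λ₀, hΛ, hcov⟩ := h
  exact ⟨Λ₀, hΛ, fun q => (hcov q).imp fun g hg => ⟨hg.1, hg.2.trans hH⟩⟩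

/-- The site-virial bound is monotone in the threshold. -/
theorem SiteVirialBound.mono {t₀ t₀' : ℝ} (ht : t₀ ≤ t₀') (h : SiteVirialBound t₀ P) : SiteVirialBound t₀' P :=
  fun y hy n hn => (h y hy n hn).trans ht

/-- ★ (R2) ⊂ (R3) on the virial clause: a site-stress-free reference satisfies the site-virial bound with threshold `0`. -/
theorem siteVirialBound_zero_of_siteStressFree (hS : IsSiteStressFree P) : SiteVirialBound 0 P := by
  intro y hy n _
  simp [hS y hy]

/-- … hence with every non-negative threshold. -/
theorem siteVirialBound_of_siteStressFree {t₀ : ℝ} (ht : 0 ≤ t₀) (hS : IsSiteStressFree P) : SiteVirialBound t₀ P :=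
  (siteVirialBound_zero_of_siteStressFree hS).mono ht

/-- The period lattice itself is a group of stabiliser translations (the covering-radius half of `HasFinePeriod` is the geometric content). -/
theorem lattice_subset_transSet (P : PeriodicConfiguration 3) : ∀ g ∈ P.lattice.toAddSubgroup, g ∈ transSet P :=
  fun _ hg => mem_transSet_of_mem_lattice hg

end FallbackR3

end Summit.AtomisticToContinuum.Crystallization.Theorems.ChargedEnergyGapChartDial

end
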